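import Literature.MathematicalPhysics.QuantumLattice.GroundStateInfraredBoundEveryState
import Mathlib.Topology.MetricSpace.Basic
import HarnessLib

/-!
# The every-ground-state infrared bound from a LOCAL (small-source) Gaussian-domination hypothesis

`GroundStateInfraredBoundEveryState.lean` proves the Kennedy–Lieb–Shastry ground-state infrared bound
in every ground-supported state from the energy-form Gaussian-domination hypothesis
`(GD_V,Q): E₀(H) ≤ E₀(H + tV + ½t²Q)` for ALL real `t`. The variational argument only uses the germ of
that hypothesis at `t = 0` (it is second-order perturbation theory): this file proves the same
conclusions from the LOCAL hypothesis `E₀(H) ≤ E₀(H + tV + ½t²Q)` for `|t| ≤ t₀` only, `t₀ > 0`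
arbitrary — the form in which a static-susceptibility ceiling `χ_V ≤ Q` (`E₀(H) − E₀(H + tV) ≤ ½Qt² + o(t²)`)
is stated, and the form of the quadratic energy floors used elsewhere in the tree
(`Summit…Theorems.NoInfraredPileUp`, `minEnergyOn (H + hV) K ≥ E₀ − Ch²` for `|h| ≤ h₀`). With the global
hypothesis one recovers the landed theorems (the global hypothesis implies the local one), so nothing
there is restated; the constant `Q` is the sharp (germ) one, not the `max(Q, 2‖V‖/t₀)` a reduction to the
global form would cost.

Results (all PROVED; no definition, no named fact): `nonneg_of_forall_small_ne_zero_poly`,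
`eq_zero_of_forall_small_linear_add_sq_nonneg` (real-variable lemmas: a polynomial inequality near `0`
controls its constant / linear coefficient); `kls_trial_poly_nonneg_of_local`;
`trace_mul_eq_zero_of_localGaussianDomination` (first order `tr(ρV) = 0`);
`infraredBound_quadratic_of_local`, `infraredBound_of_local`, `infraredBound_doubleCommutator_of_local`
(`(Re tr ρV²)² ≤ ¼Q·Re trρ·Re tr ρ[V,[H,V]]`), and the certified-input mode ceiling
`trace_sq_le_half_sqrt_of_local` (`Re tr(ρV²) ≤ ½√(QD)` for a ground-supported density matrix).

## References
* T. Kennedy, E. H. Lieb, B. S. Shastry, J. Stat. Phys. 53 (1988) 1019–1030 [KLS1988JSP], eqs. (12)–(14),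
  (18)–(19).
* L. Pitaevskii, S. Stringari, J. Low Temp. Phys. 85 (1991) 377–388 [PitaevskiiStringari1991], §2
  (`m₀² ≤ m₁ m₋₁`, the susceptibility as the small-source energy curvature).
-/

noncomputable section

open Matrix Finset Filter Topology
open scoped ComplexOrder

namespace Literature.MathematicalPhysics.QuantumLattice

variable {m : Type*} [Fintype m] [DecidableEq m]

/-! ### Two real-variable lemmas -/

/-- A polynomial inequality `0 ≤ f + t g + t² h` for all `0 < |t| ≤ t₀` forces `0 ≤ f` (let `t → 0`).
[folklore] -/
private theorem nonneg_of_forall_small_ne_zero_poly {f g h t₀ : ℝ} (ht₀ : 0 < t₀)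
    (H : ∀ t : ℝ, t ≠ 0 → |t| ≤ t₀ → 0 ≤ f + t * g + t ^ 2 * h) : 0 ≤ f := by
  have hc : Continuous fun t : ℝ => f + t * g + t ^ 2 * h := by fun_prop
  have hlim : Tendsto (fun t : ℝ => f + t * g + t ^ 2 * h) (𝓝[≠] 0) (𝓝 f) := by
    have := hc.tendsto 0
    simp only [zero_mul, add_zero, ne_eq, OfNat.ofNat_ne_zero, not_false_eq_true, zero_pow] at this
    exact this.mono_left nhdsWithin_le_nhds
  have hball : ∀ᶠ t in 𝓝 (0 : ℝ), |t| ≤ t₀ :=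
    Metric.eventually_nhds_iff.2 ⟨t₀, ht₀, fun y hy => by
      rw [Real.dist_eq, sub_zero] at hy; exact hy.le⟩
  refine ge_of_tendsto hlim ?_
  exact (eventually_nhdsWithin_of_eventually_nhds hball).mp
    (eventually_nhdsWithin_of_forall fun t ht hle => H t ht hle)

/-- `0 ≤ t v + t² c` for all `0 < |t| ≤ t₀` forces `v = 0` (divide by `t` of either sign, let `t → 0`).
[folklore] -/
private theorem eq_zero_of_forall_small_linear_add_sq_nonneg {v c t₀ : ℝ} (ht₀ : 0 < t₀)
    (H : ∀ t : ℝ, t ≠ 0 → |t| ≤ t₀ → 0 ≤ t * v + t ^ 2 * c) : v = 0 := by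
  have hc : Continuous fun t : ℝ => v + t * c := by fun_prop
  have hlim : ∀ s : Set ℝ, Tendsto (fun t : ℝ => v + t * c) (𝓝[s] 0) (𝓝 v) := fun s => by
    have := hc.tendsto 0
    simp only [zero_mul, add_zero] at this
    exact this.mono_left nhdsWithin_le_nhds
  have hball : ∀ᶠ t in 𝓝 (0 : ℝ), |t| ≤ t₀ :=
    Metric.eventually_nhds_iff.2 ⟨t₀, ht₀, fun y hy => by
      rw [Real.dist_eq, sub_zero] at hy; exact hy.le⟩
  -- `t > 0`: `v + t c ≥ 0`
  have h1 : 0 ≤ v := by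
    refine ge_of_tendsto (hlim (Set.Ioi 0)) ?_
    refine (eventually_nhdsWithin_of_eventually_nhds hball).mp
      (eventually_nhdsWithin_of_forall fun t (ht : 0 < t) hle => ?_)
    have h := H t ht.ne' hle
    have : 0 ≤ t * (v + t * c) := by nlinarith [h]
    exact nonneg_of_mul_nonneg_right (by linarith [this]) ht
  -- `t < 0`: `v + t c ≤ 0`
  have h2 : v ≤ 0 := by
    refine le_of_tendsto (hlim (Set.Iio 0)) ?_
    refine (eventually_nhdsWithin_of_eventually_nhds hball).mp
      (eventually_nhdsWithin_of_forall fun t (ht : t < 0) hle => ?_)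
    have h := H t ht.ne hle
    have : 0 ≤ t * (v + t * c) := by nlinarith [h]
    nlinarith [this, ht]
  exact le_antisymm h2 h1

/-! ### The variational argument under the local hypothesis -/

section Local

variable {H V ρ : Matrix m m ℂ} {Q t₀ : ℝ}

/-- The core real inequality `0 ≤ Re tr((1+tμV)ρ(1+tμV)(H − E₀ + tV + ½t²Q))`, expanded in `t, μ`, for
the sources `|t| ≤ t₀` where the hypothesis `E₀(H) ≤ E₀(H + tV + ½t²Q)` is assumed.
[cite: KLS1988JSP, eqs. (18)–(19)] -/
theorem kls_trial_poly_nonneg_of_local (hH : H.IsHermitian) (hV : V.IsHermitian) (hρ : ρ.PosSemidef)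
    (hHρ : H * ρ = (H.groundEnergy : ℂ) • ρ)
    (hGD : ∀ t : ℝ, |t| ≤ t₀ → H.groundEnergy ≤
      (H + (t : ℂ) • V + ((t ^ 2 * Q / 2 : ℝ) : ℂ) • (1 : Matrix m m ℂ)).groundEnergy)
    {t : ℝ} (ht : |t| ≤ t₀) (μ : ℝ) :
    0 ≤ t * (ρ * V).trace.re + (t ^ 2 * Q / 2) * ρ.trace.re +
      (2 * (t * μ)) * (t * (ρ * (V * V)).trace.re + (t ^ 2 * Q / 2) * (ρ * V).trace.re) +
      (t * μ) ^ 2 * ((ρ * (V * (H - (H.groundEnergy : ℂ) • 1) * V)).trace.re +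
        t * (ρ * (V * V * V)).trace.re + (t ^ 2 * Q / 2) * (ρ * (V * V)).trace.re) := by
  set K : Matrix m m ℂ := H - (H.groundEnergy : ℂ) • 1 with hK_def
  have hρH : ρ * H = (H.groundEnergy : ℂ) • ρ := by
    have h := congrArg conjTranspose hHρ
    rwa [conjTranspose_mul, conjTranspose_smul, hρ.1.eq, hH.eq, Complex.star_def,
      Complex.conj_ofReal] at h
  have hKρ : K * ρ = 0 := by
    rw [hK_def, sub_mul, hHρ, Matrix.smul_mul, one_mul, sub_self]
  have hρK : ρ * K = 0 := by
    rw [hK_def, mul_sub, hρH, Matrix.mul_smul, mul_one, sub_self]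
  have hM : (K + (t : ℂ) • V + ((t ^ 2 * Q / 2 : ℝ) : ℂ) • (1 : Matrix m m ℂ)).PosSemidef := by
    have hX : (H + (t : ℂ) • V + ((t ^ 2 * Q / 2 : ℝ) : ℂ) • (1 : Matrix m m ℂ)).IsHermitian :=
      (hH.add (hV.ofReal_smul t)).add (isHermitian_one.ofReal_smul _)
    have h := posSemidef_sub_of_groundEnergy_le hX (hGD t ht)
    convert h using 1
    rw [hK_def]
    abel
  have hS : ((1 + ((t * μ : ℝ) : ℂ) • V) * ρ * (1 + ((t * μ : ℝ) : ℂ) • V)).PosSemidef := by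
    have h := hρ.mul_mul_conjTranspose_same (1 + ((t * μ : ℝ) : ℂ) • V)
    rwa [conjTranspose_add, conjTranspose_one, conjTranspose_smul, hV.eq, Complex.star_def,
      Complex.conj_ofReal] at h
  have h0 := Literature.LinearAlgebra.Matrix.re_trace_mul_nonneg_of_posSemidef hS hM
  rw [trace_conj_trial_mul_expansion hKρ hρK t (t * μ) (t ^ 2 * Q / 2)] at h0
  simpa only [Complex.add_re, Complex.re_ofReal_mul] using h0

/-- **First order from the local hypothesis**: `tr(ρV) = 0` for every `ρ ⪰ 0` with `Hρ = E₀ρ`, if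
`E₀(H) ≤ E₀(H + tV + ½t²Q)` for `|t| ≤ t₀`, `t₀ > 0`. [cite: KLS1988JSP, eqs. (18)–(19)] -/
theorem trace_mul_eq_zero_of_localGaussianDomination (hH : H.IsHermitian) (hV : V.IsHermitian)
    (hρ : ρ.PosSemidef) (hHρ : H * ρ = (H.groundEnergy : ℂ) • ρ) (ht₀ : 0 < t₀)
    (hGD : ∀ t : ℝ, |t| ≤ t₀ → H.groundEnergy ≤
      (H + (t : ℂ) • V + ((t ^ 2 * Q / 2 : ℝ) : ℂ) • (1 : Matrix m m ℂ)).groundEnergy) :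
    (ρ * V).trace = 0 := by
  have hre : (ρ * V).trace.re = 0 := by
    refine eq_zero_of_forall_small_linear_add_sq_nonneg (c := Q / 2 * ρ.trace.re) ht₀
      fun t _ hle => ?_
    have h := kls_trial_poly_nonneg_of_local hH hV hρ hHρ hGD hle 0
    simp only [mul_zero, zero_mul, add_zero, ne_eq, OfNat.ofNat_ne_zero, not_false_eq_true,
      zero_pow] at h
    nlinarith [h]
  have him : (ρ * V).trace.im = 0 := by
    have h : star (ρ * V).trace = (ρ * V).trace := by
      rw [← trace_conjTranspose, conjTranspose_mul, hρ.1.eq, hV.eq, trace_mul_comm]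
    have := congrArg Complex.im h
    rw [Complex.star_def, Complex.conj_im] at this
    linarith
  exact Complex.ext hre him

/-- **Second order from the local hypothesis**: for every real `μ`,
`0 ≤ ½Q · Re trρ + 2μ · Re tr(ρV²) + μ² · Re tr(ρ V(H−E₀)V)`. [cite: KLS1988JSP, eqs. (18)–(19)] -/
theorem infraredBound_quadratic_of_local (hH : H.IsHermitian) (hV : V.IsHermitian)
    (hρ : ρ.PosSemidef) (hHρ : H * ρ = (H.groundEnergy : ℂ) • ρ) (ht₀ : 0 < t₀)
    (hGD : ∀ t : ℝ, |t| ≤ t₀ → H.groundEnergy ≤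
      (H + (t : ℂ) • V + ((t ^ 2 * Q / 2 : ℝ) : ℂ) • (1 : Matrix m m ℂ)).groundEnergy) (μ : ℝ) :
    0 ≤ Q / 2 * ρ.trace.re + 2 * μ * (ρ * (V * V)).trace.re +
      μ ^ 2 * (ρ * (V * (H - (H.groundEnergy : ℂ) • 1) * V)).trace.re := by
  have hv0 : (ρ * V).trace.re = 0 := by
    rw [trace_mul_eq_zero_of_localGaussianDomination hH hV hρ hHρ ht₀ hGD, Complex.zero_re]
  set a : ℝ := (ρ * (V * V)).trace.re
  set b : ℝ := (ρ * (V * (H - (H.groundEnergy : ℂ) • 1) * V)).trace.re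
  set c₃ : ℝ := (ρ * (V * V * V)).trace.re
  have hquad : 0 ≤ b * (μ * μ) + 2 * a * μ + Q / 2 * ρ.trace.re := by
    refine nonneg_of_forall_small_ne_zero_poly (g := μ ^ 2 * c₃) (h := μ ^ 2 * (Q / 2) * a) ht₀
      fun t ht hle => ?_
    have h1 := kls_trial_poly_nonneg_of_local hH hV hρ hHρ hGD hle μ
    rw [hv0] at h1
    have ht2 : 0 < t ^ 2 := by positivity
    refine (mul_nonneg_iff_of_pos_left ht2).1 ?_
    nlinarith [h1]
  nlinarith [hquad]

/-- **The infrared bound in every ground state from the local hypothesis**: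
`(Re tr(ρV²))² ≤ ½Q · Re trρ · Re tr(ρ V(H−E₀)V)`. [cite: KLS1988JSP, eqs. (12), (14)] -/
theorem infraredBound_of_local (hH : H.IsHermitian) (hV : V.IsHermitian) (hρ : ρ.PosSemidef)
    (hHρ : H * ρ = (H.groundEnergy : ℂ) • ρ) (ht₀ : 0 < t₀)
    (hGD : ∀ t : ℝ, |t| ≤ t₀ → H.groundEnergy ≤
      (H + (t : ℂ) • V + ((t ^ 2 * Q / 2 : ℝ) : ℂ) • (1 : Matrix m m ℂ)).groundEnergy) :
    (ρ * (V * V)).trace.re ^ 2 ≤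
      Q / 2 * ρ.trace.re * (ρ * (V * (H - (H.groundEnergy : ℂ) • 1) * V)).trace.re := by
  have hq : ∀ x : ℝ, 0 ≤ (ρ * (V * (H - (H.groundEnergy : ℂ) • 1) * V)).trace.re * (x * x) +
      2 * (ρ * (V * V)).trace.re * x + Q / 2 * ρ.trace.re := by
    intro x
    have h := infraredBound_quadratic_of_local hH hV hρ hHρ ht₀ hGD x
    linarith [h]
  have hd := discrim_le_zero hq
  rw [discrim] at hd
  nlinarith [hd]

/-- **Double-commutator form from the local hypothesis**:
`(Re tr(ρV²))² ≤ ¼Q · Re trρ · Re tr(ρ[V,[H,V]])`. [cite: KLS1988JSP, eqs. (12)–(13)] -/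
theorem infraredBound_doubleCommutator_of_local (hH : H.IsHermitian) (hV : V.IsHermitian)
    (hρ : ρ.PosSemidef) (hHρ : H * ρ = (H.groundEnergy : ℂ) • ρ) (ht₀ : 0 < t₀)
    (hGD : ∀ t : ℝ, |t| ≤ t₀ → H.groundEnergy ≤
      (H + (t : ℂ) • V + ((t ^ 2 * Q / 2 : ℝ) : ℂ) • (1 : Matrix m m ℂ)).groundEnergy) :
    (ρ * (V * V)).trace.re ^ 2 ≤
      Q / 4 * ρ.trace.re * (ρ * (V * (H * V - V * H) - (H * V - V * H) * V)).trace.re := by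
  have h := infraredBound_of_local hH hV hρ hHρ ht₀ hGD
  have hρH : ρ * H = (H.groundEnergy : ℂ) • ρ := by
    have h' := congrArg conjTranspose hHρ
    rwa [conjTranspose_mul, conjTranspose_smul, hρ.1.eq, hH.eq, Complex.star_def,
      Complex.conj_ofReal] at h'
  rw [trace_mul_sub_mul_eq_half_doubleCommutator hHρ hρH,
    show (1 / 2 : ℂ) = ((1 / 2 : ℝ) : ℂ) by push_cast; ring, Complex.re_ofReal_mul] at h
  linarith [h]

/-- **Certified-input mode ceiling from the local hypothesis.** For a ground-supported density matrix
(`ρ ⪰ 0`, `Hρ = E₀ρ`, `tr ρ = 1`), `0 ≤ Q` with `E₀(H) ≤ E₀(H + tV + ½t²Q)` for `|t| ≤ t₀` (`t₀ > 0`),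
and `Re tr(ρ[V,[H,V]]) ≤ D`: `Re tr(ρV²) ≤ ½√(QD)`. [cite: KLS1988JSP, eqs. (12)–(14)]
[cite: PitaevskiiStringari1991, §2] -/
theorem trace_sq_le_half_sqrt_of_local (hH : H.IsHermitian) (hV : V.IsHermitian)
    (hρ : ρ.PosSemidef) (hHρ : H * ρ = (H.groundEnergy : ℂ) • ρ) (htr : ρ.trace = 1) (hQ : 0 ≤ Q)
    (ht₀ : 0 < t₀)
    (hGD : ∀ t : ℝ, |t| ≤ t₀ → H.groundEnergy ≤
      (H + (t : ℂ) • V + ((t ^ 2 * Q / 2 : ℝ) : ℂ) • (1 : Matrix m m ℂ)).groundEnergy)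
    {D : ℝ} (hD : (ρ * (V * (H * V - V * H) - (H * V - V * H) * V)).trace.re ≤ D) :
    (ρ * (V * V)).trace.re ≤ Real.sqrt (Q * D) / 2 := by
  have h := infraredBound_doubleCommutator_of_local hH hV hρ hHρ ht₀ hGD
  rw [htr, Complex.one_re, mul_one] at h
  have ha : 0 ≤ (ρ * (V * V)).trace.re := by
    have hVV : (V * V).PosSemidef := by
      simpa only [hV.eq] using posSemidef_conjTranspose_mul_self V
    exact Literature.LinearAlgebra.Matrix.re_trace_mul_nonneg_of_posSemidef hρ hVV
  have h2 : (ρ * (V * V)).trace.re ^ 2 ≤ Q / 4 * D := by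
    rcases hQ.eq_or_lt with hQ0 | hQpos
    · rw [← hQ0] at h ⊢; simpa using h
    · exact h.trans (by nlinarith [hD])
  have hQD : 0 ≤ Q * D := by nlinarith [sq_nonneg ((ρ * (V * V)).trace.re)]
  have h3 : (2 * (ρ * (V * V)).trace.re) ^ 2 ≤ Q * D := by nlinarith [h2]
  have h4 : 2 * (ρ * (V * V)).trace.re ≤ Real.sqrt (Q * D) := by
    rw [← Real.sqrt_sq (by linarith : 0 ≤ 2 * (ρ * (V * V)).trace.re)]
    exact Real.sqrt_le_sqrt h3
  linarith

end Local

end Literature.MathematicalPhysics.QuantumLattice
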